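import Literature.AnabelianGeometry.EtaleTheta.Discharge.Sec5ThetaSubquotientLevelNOfConnectedTemperoid
import Literature.AnabelianGeometry.EtaleTheta.Discharge.Sec5Prop55OfConnectedTemperoidData

/-!
# [EtTh] Prop. 5.5 at the genuine §5 data over `B^temp(Π^tp_X)⁰` with `Q := levelStub` (level `N`): the binders `hpre`, `hlift`, `hgeom` DISCHARGED down to one equation on `P` at `B_N^bs`

Mochizuki, *The étale theta function and its Frobenioid-theoretic manifestations*, Publ. RIMS **45** (2009), Prop. 5.5 pp. 327–328 (PDF pp. 101–102);
§5 p. 330–331 (PDF pp. 104–105).  [cite: MochizukiEtTh2009, Prop 5.5 p.327–328 (PDF pp.101–102)]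

PROOF-ONLY (no definitions).  abc-iut cell, seat abc-iut-w4-d042 (gen 3), offer O1 (capstone part) on the row «MERGE-PLAN row 2 (D) + G-w5d123-2 AT THE
GENUINE (Q,P)» (L2-lead GO-O1 2026-08-26T07:15Z).  abc-iut-L2-t4's `ThetaFrobenioid.cyclotomicRigidity_ofConnectedTemperoidData_of_pullRoot` (p430047)
proves [EtTh] Prop. 5.5 for the genuine §5 data `ofConnectedTemperoidData h Q …` over `B^temp(Π^tp_X)⁰` modulo the named binders `hB P hη₀ hdies e he hlift hpre
hPproj ν hK hgeom hconst hreach hLc hLi hproj hKR`, for a FREE subquotient stub `Q` and a FREE `P : ThetaSubquotientProj`.  Here `Q` is SPECIALISED to the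
LEVEL-`N` genuine stub `Q := RD.levelStub ιX` (`ThetaSubquotientLevelN.lean`, p430659: abc-iut-L2-t9's `thetaSubquotientStub` at `(q_N, ι_N)` read off
abc-iut-L2-t2's `RigidData`; `Λ := μ_N`) over abc-iut-L2-t4's §5 choice `A_⊙^bs := Ÿ` (`mkOfConnectedTemperoidYdd X tf hZ hP NH RD.toThetaEnvData ιX`;
universe specialisation `V : FrdIMonoidStub.{max u₀ w'}` so that `Λ = μ_N : Type (max u₀ w')` fits), and, given the ONE equation

  `hPpre : P.pre B_N^bs = (autPre q_N ι_N (B_N^bs)).comap mapAut`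

(`P` AT `B_N^bs` is print's `Aut`-subquotient domain — abc-iut-L2-t9's `autPre`, read in `Aut_D(B_N^bs)` through `(connectedObjects _).ι.mapAut`), the three
binders `hpre` (`hpre_levelN`), `hlift` (`hlift_levelN` — NO residual subgroup hypothesis) and `hgeom` (`hgeom_levelN`) are THEOREMS, in EXACTLY p430047's
binder types (so they can be passed positionally).  Also: `ofConnectedTemperoidData_levelN_stub` / `ofConnectedTemperoidData_levelN_lDeltaMap` (the data's
stub IS `levelStub`, its transport IS abc-iut-L2-t9's `map` — `rfl`), from which `hLc` / `hLi` follow by abc-iut-w4-d008's `ThetaSubquotient.map_comp` /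
`map_id` and `hproj` by `map_autProj_eq_autProj_conj` (p429126); and the base-point evaluation behind `hPproj` is
`evalAt_autProj_rho_eq_thetaMod_inv` (`Discharge/Sec5ThetaSubquotientLevelNOfConnectedTemperoid.lean`): those three compositions are NOT restated here (at this
four-deep definitional stack — `ofConnectedTemperoidData ∘ ofBiKummerData ∘ ofRootData ∘ ofThetaEnvData` over `mkOfConnectedTemperoidYdd` — the direct
`exact`s exceed the default heartbeat budget; a consumer rewrites with `ofConnectedTemperoidData_levelN_lDeltaMap` first).

WHY AN EQUATION AND NOT A TERM (honest): abc-iut-L2-t4's FROZEN `ThetaSubquotientProj 𝔉` asks `proj_surjective` at EVERY object of `B^temp(Π^tp_X)⁰`, and the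
genuine `Aut`-projection is onto only at Galois objects (GAP-LEDGER G-w4d042g3-1, v-next `proj_surjective_of_isGaloisObj`) — so no `P` is constructed here;
the equation pins `P` where Prop. 5.5 / Thm. 5.6 evaluate it (`B_N^bs`, Galois).  Nothing of [EtTh]'s curves is asserted; no side taken on [IUTchIII] Cor. 3.12.
-/

noncomputable section

namespace Literature.AnabelianGeometry.EtaleTheta

namespace ThetaFrobenioid

open CategoryTheory Opposite FrobenioidCyclotomicRigidity Literature.AlgebraicGeometry.Frobenioids
  Literature.AnabelianGeometry.SemiGraphs Literature.AnabelianGeometry.SemiGraphs.GaloisObjects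
open Literature.AlgebraicGeometry.Frobenioids.QuasiTemperoid (stabilizerSubgroup)

universe u₀ v₀ w'

section LevelN

variable {K : Type u₀} [Field K] {X : SemiGraphs.TemperedArithmeticGroup.{u₀} K} {D₀ : Type u₀} [Category.{v₀} D₀]
  {V : FrdIMonoidStub.{max u₀ w'}} {T₀ : RealifiedDivisorMonoids (D₀ := D₀) V}
  {VD : FrdICatStub.{u₀ + 1, u₀, max u₀ w'} (ConnectedPart (BTemp X.Pi))}
  {tf : TemperedFrobenioid T₀ (ConnectedPart (BTemp X.Pi)) VD} {hZ : tf.monoidType = MonoidType.Z}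
  {hP : ∀ A : (ConnectedPart (BTemp X.Pi))ᵒᵖ, IsPerfect (tf.Φ.carrier A)}
  {NH : Subgroup (Field.absoluteGaloisGroup K) → tf.category → ℕ+ → Prop}
  {lv N : ℕ+} {l' : ℕ} {RD : RigidData.{max u₀ w'} N l'} {ιX : RD.PiX ≃ₜ* X.Pi}
  {pullFrac : ∀ {A A' : (BiKummerSetting.mkOfConnectedTemperoidYdd X tf hZ hP NH RD.toThetaEnvData ιX).C} (_ : A' ⟶ A),
    (BiKummerSetting.mkOfConnectedTemperoidYdd X tf hZ hP NH RD.toThetaEnvData ιX).biratUnits A →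
      (BiKummerSetting.mkOfConnectedTemperoidYdd X tf hZ hP NH RD.toThetaEnvData ιX).biratUnits A'}
  {θ : (BiKummerSetting.mkOfConnectedTemperoidYdd X tf hZ hP NH RD.toThetaEnvData ιX).biratUnits
    (BiKummerSetting.mkOfConnectedTemperoidYdd X tf hZ hP NH RD.toThetaEnvData ιX).Aodot}
  {Bl : (BiKummerSetting.mkOfConnectedTemperoidYdd X tf hZ hP NH RD.toThetaEnvData ιX).C}
  {Pl : (BiKummerSetting.mkOfConnectedTemperoidYdd X tf hZ hP NH RD.toThetaEnvData ιX).FractionPair θ Bl}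
  {Rl : (BiKummerSetting.mkOfConnectedTemperoidYdd X tf hZ hP NH RD.toThetaEnvData ιX).NthRoot θ Pl lv pullFrac}
  [RD.iotaN.range.Normal]
  (h : ModelFrobenioid.Hypotheses tf.divisorMonoid tf.ratFnFunctor) (odd_l : Odd (lv : ℕ))
  (R : (BiKummerSetting.mkOfConnectedTemperoidYdd X tf hZ hP NH RD.toThetaEnvData ιX).NthRoot Rl.root Rl.pair N pullFrac)
  (K' : Type (max u₀ w')) [Field K'] (constEmb : K'ˣ →* tf.biratUnitsModel R.BN) (constEmb_injective : Function.Injective constEmb)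
  (hinvc : ∀ g : Aut R.AN.base,
    pull tf.divisorMonoid g.hom (ModelFrobenioid.div R.pair.num) = ModelFrobenioid.div R.pair.num)
  (hinvp : ∀ y : RD.PiX, y ∈ RD.PiYdd →
    pull tf.divisorMonoid ((BiKummerSetting.mkOfConnectedTemperoidYdd X tf hZ hP NH RD.toThetaEnvData ιX).galoisSurj R.AN.base
      R.αData.isGalois (ιX y)).hom (ModelFrobenioid.div R.pair.den) = ModelFrobenioid.div R.pair.den)

omit [RD.iotaN.range.Normal] in
/-- Reading `Aut_D(B_N^bs)` in `Aut(B_N^bs.obj)` is injective (full subcategory). [cite: MochizukiEtTh2009, §5 p.331 (PDF p.105)] -/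
theorem eq_of_mapAut_eq' {a b : Aut R.BN.base}
    (hab : Functor.mapAut R.BN.base (connectedObjects (BTemp X.Pi)).ι a = Functor.mapAut R.BN.base (connectedObjects (BTemp X.Pi)).ι b) :
    a = b :=
  Iso.ext (ObjectProperty.hom_ext _ (congrArg Iso.hom hab))

omit [RD.iotaN.range.Normal] in
/-- The subquotient stub of the level-`N` data IS `levelStub` (definitionally). [cite: MochizukiEtTh2009, §5 p.327 (PDF p.101)] -/
theorem ofConnectedTemperoidData_levelN_stub :
    (ofConnectedTemperoidData h (RD.levelStub ιX) odd_l R ιX K' constEmb constEmb_injective hinvc hinvp).toThetaSubquotientStub = RD.levelStub ιX := rfl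

/-- Transport of the level-`N` data along `f` IS abc-iut-L2-t9's `map` (definitionally). [cite: MochizukiEtTh2009, §5 p.327 (PDF p.101)] -/
theorem ofConnectedTemperoidData_levelN_lDeltaMap {E E' : ConnectedPart (BTemp X.Pi)} (f : E ⟶ E') :
    (ofConnectedTemperoidData h (RD.levelStub ιX) odd_l R ιX K' constEmb constEmb_injective hinvc hinvp).lDeltaMap f = ThetaSubquotient.map (RD.qN ιX) RD.iotaN E.property E'.property f.hom := rfl

variable (P : ThetaSubquotientProj (ofConnectedTemperoidData h (RD.levelStub ιX) odd_l R ιX K' constEmb constEmb_injective hinvc hinvp))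
  (hPpre : P.pre R.BN.base =
    (ThetaSubquotient.autPre (RD.qN ιX) RD.iotaN R.BN.base.obj).comap (Functor.mapAut R.BN.base (connectedObjects (BTemp X.Pi)).ι))

include hPpre

/-- **hpre DISCHARGED**: `k ∈ Π^tp_Ÿ ∩ (l·Δ_Θ) ⇒ ρ k ∈ P.pre`. [cite: MochizukiEtTh2009, Prop 5.5 p.327 (PDF p.101)] -/
theorem hpre_levelN : ∀ k : RD.PiYdd, (k : RD.PiX) ∈ RD.lDeltaTheta →
    rhoOfBiKummerData R ιX k ∈ P.pre R.BN.base := by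
  intro k hk
  rw [hPpre]
  exact mapAut_rho_mem_autPre_of_coe_mem_lDeltaTheta R ιX k hk

omit [RD.iotaN.range.Normal] in
/-- **hlift DISCHARGED** (`A_⊙^bs := Ÿ`): an element of `H_{B_N} = ρ(Π^tp_Ÿ)` lying in `P.pre` lifts to `Π^tp_Ÿ ∩ (l·Δ_Θ)`.
[cite: MochizukiEtTh2009, Prop 5.5 proof p.327–328 (PDF pp.101–102)] -/
theorem hlift_levelN : ∀ a ∈ (ofConnectedTemperoidData h (RD.levelStub ιX) odd_l R ιX K' constEmb constEmb_injective hinvc hinvp).HB,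
    a ∈ P.pre R.BN.base → ∃ k : RD.PiYdd, (k : RD.PiX) ∈ RD.lDeltaTheta ∧ rhoOfBiKummerData R ιX k = a := by
  intro a ha hm
  change a ∈ RD.PiYdd.map (rhoOfBiKummerData R ιX) at ha
  obtain ⟨k₀, hk₀, rfl⟩ := ha
  rw [hPpre] at hm
  exact exists_lift_rho_PiYdd_lDeltaTheta R ⟨k₀, hk₀⟩ hm

omit [RD.iotaN.range.Normal] in
/-- **hgeom DISCHARGED**: `P.pre ≤ ρ(Ker(Π^tp_X ↠ G_K))` (`(l·Δ_Θ) ≤ Δ^tp_X`). [cite: MochizukiEtTh2009, §2 p.45] -/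
theorem hgeom_levelN : P.pre R.BN.base ≤ RD.aug.ker.map (rhoOfBiKummerData R ιX) := by
  intro g hg
  rw [hPpre] at hg
  obtain ⟨k, hk, hρ⟩ := exists_mem_lDeltaTheta_mapAut_rho_eq_of_mem_autPre R ιX hg
  exact ⟨k, (RD.lDeltaTheta_le hk).2, eq_of_mapAut_eq' R hρ⟩

end LevelN

end ThetaFrobenioid

end Literature.AnabelianGeometry.EtaleTheta
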